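import Summits.CriticalPhenomena.PercolationContinuityZ3.Theorems.PercLowPointHalfSpaceLowPointBookkeepingStubFloorCouplingLabels
import Summits.CriticalPhenomena.PercolationContinuityZ3.Theorems.PercLowPointHalfSpaceLowPointBookkeepingStubFloorCouplingCluster
import Summits.CriticalPhenomena.PercolationContinuityZ3.Theorems.PercLowPointHalfSpaceFloorSubcritical

/-!
# Stub `stub_floorCoupling` of crux `LowPointBookkeeping` (stmt-CriticalPhenomena-14713), part 3: the pivotal floor edge

Helper file 3/4: the concrete label coupling of the floor-diluted half-space measures and the PATHWISE
statement — on `{a ↔_ℍ b} ∖ {a ↔_{ℍ₊} b}` at level `p_c`, for good labels, some ordered floor pair is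
pivotal at the level of its own label (`Coupling.exists_oPiv`). Lands `--supports stmt-CriticalPhenomena-14713`
with the registered def-free sub-goal `stub_floorCouplingPivot` (floor edges are the pairs `s(x, x + e)`).
-/

noncomputable section

namespace Summit.CriticalPhenomena.PercolationContinuityZ3.Theorems.FloorRusso.Coupling

open MeasureTheory Measure Set
open Literature.Probability.Percolation Literature.Probability.LatticeModels
open scoped ENNReal

/-! ### Removing the floor edges confines `ℍ`-paths between points of `ℍ₊` to `ℍ₊` -/

section Pendant

/-- In a configuration of half-space lattice edges with no floor edge, every open neighbour of a
floor vertex is the vertex straight above it. -/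
theorem eq_add_single_of_adj_floor {ω : BondConfig (Site 3)} (hω : ω ⊆ halfSpaceEdgeSet 3)
    (hfl : ∀ e ∈ floorEdgeSet 3, e ∉ ω) {u v : Site 3} (hadj : (openGraph ω).Adj u v) (hv : v 0 = 0) :
    u = v + Pi.single 0 1 := by
  obtain ⟨hmem, -⟩ := (openGraph_adj _ _ _).1 hadj
  have hH := hω hmem
  obtain ⟨hE, hcoord⟩ := hH
  have hu0 : 0 ≤ u 0 := hcoord u (Sym2.mem_mk_left _ _)
  have hune : u 0 ≠ 0 := by
    intro hu
    exact hfl _ ⟨hE, fun z hz => by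
      rcases Sym2.mem_iff.1 hz with rfl | rfl
      · exact hu
      · exact hv⟩ hmem
  have hadjG : (zdGraph 3).Adj u v := by simpa using hE
  obtain ⟨i, h | h⟩ := (zdGraph_adj_iff u v).1 hadjG
  · -- v = u + e_i : then v 0 ≥ u 0, forcing u 0 = 0
    exfalso
    have := congrFun h 0
    simp only [Pi.add_apply] at this
    by_cases hi : i = 0
    · subst hi; simp at this; omega
    · rw [Pi.single_eq_of_ne (show (0 : Fin 3) ≠ i from fun h => hi h.symm)] at this; omega
  · -- u = v + e_i with i = 0
    have h0 := congrFun h 0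
    simp only [Pi.add_apply] at h0
    by_cases hi : i = 0
    · subst hi; exact h
    · rw [Pi.single_eq_of_ne (show (0 : Fin 3) ≠ i from fun h => hi h.symm)] at h0; omega

/-- A path of open half-space edges avoiding floor edges, between two vertices off the floor, never
visits the floor. -/
theorem forall_support_ne_floor {ω : BondConfig (Site 3)} (hω : ω ⊆ halfSpaceEdgeSet 3)
    (hfl : ∀ e ∈ floorEdgeSet 3, e ∉ ω) {u b : Site 3} (p : (openGraph ω).Walk u b) (hp : p.IsPath)
    (hu : u 0 ≠ 0) (hb : b 0 ≠ 0) : ∀ v ∈ p.support, v 0 ≠ 0 := by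
  induction p with
  | nil => simpa using hb
  | @cons u v w huv q ih =>
    have hv : v 0 ≠ 0 := by
      cases q with
      | nil => exact hb
      | @cons _ w' _ hvw q' =>
        intro hv0
        have h1 : u = v + Pi.single 0 1 := eq_add_single_of_adj_floor hω hfl huv hv0
        have h2 : w' = v + Pi.single 0 1 := eq_add_single_of_adj_floor hω hfl hvw.symm hv0
        have hnd := hp.support_nodup
        simp only [SimpleGraph.Walk.support_cons, List.nodup_cons, List.mem_cons] at hnd
        exact hnd.1 (Or.inr (by rw [h1, ← h2]; exact SimpleGraph.Walk.start_mem_support _))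
    intro x hx
    rw [SimpleGraph.Walk.support_cons, List.mem_cons] at hx
    rcases hx with rfl | hx
    · exact hu
    · exact ih hp.of_cons hv hb x hx

/-- The vertices of an open walk starting in `ℍ` all lie in `ℍ` (open edges are half-space
edges). -/
theorem forall_support_mem_halfSpace {ω : BondConfig (Site 3)} (hω : ω ⊆ halfSpaceEdgeSet 3)
    {u b : Site 3} (p : (openGraph ω).Walk u b) (hu : 0 ≤ u 0) : ∀ v ∈ p.support, 0 ≤ v 0 := by
  induction p with
  | nil => simpa using hu
  | @cons u v w huv q ih =>
    intro x hx
    rw [SimpleGraph.Walk.support_cons, List.mem_cons] at hx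
    rcases hx with rfl | hx
    · exact hu
    · exact ih ((hω ((openGraph_adj _ _ _).1 huv).1).2 _ (Sym2.mem_mk_right _ _)) x hx

/-- A walk all of whose vertices lie in `T` is a walk of the induced graph on `T`. -/
theorem reachable_induce_of_support {V : Type*} {G : SimpleGraph V} {T : Set V} {u b : V}
    (p : G.Walk u b) (hT : ∀ v ∈ p.support, v ∈ T) :
    (G.induce T).Reachable ⟨u, hT u p.start_mem_support⟩ ⟨b, hT b p.end_mem_support⟩ := by
  induction p with
  | nil => exact SimpleGraph.Reachable.refl _
  | @cons u v w huv q ih =>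
    have hu : u ∈ T := hT u (by simp)
    have hq : ∀ x ∈ q.support, x ∈ T := fun x hx => hT x (by simp [hx])
    have hv : v ∈ T := hq v q.start_mem_support
    have hadj : (G.induce T).Adj ⟨u, hu⟩ ⟨v, hv⟩ := huv
    exact hadj.reachable.trans (ih hq)

/-- **No floor edges ⇒ `ℍ`-connections of `ℍ₊`-points are `ℍ₊`-connections.** -/
theorem conn_upper_of_no_floor {ω : BondConfig (Site 3)} (hω : ω ⊆ halfSpaceEdgeSet 3)
    (hfl : ∀ e ∈ floorEdgeSet 3, e ∉ ω) {a b : Site 3} (ha : 1 ≤ a 0) (hb : 1 ≤ b 0)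
    (hab : ω ∈ openConnIn {x : Site 3 | 0 ≤ x 0} a b) :
    ω ∈ openConnIn {x : Site 3 | 1 ≤ x 0} a b := by
  have hr : (openGraph ω).Reachable a b := LowPoint.conn_reachable hab
  obtain ⟨p, hp⟩ := hr.exists_isPath
  have hsupp := forall_support_ne_floor hω hfl p hp (by omega) (by omega)
  have hH := forall_support_mem_halfSpace hω p (by omega)
  have hP : ∀ v ∈ p.support, v ∈ {x : Site 3 | 1 ≤ x 0} := fun v hv => by
    have := hH v hv; have := hsupp v hv; show 1 ≤ v 0; omega
  exact ⟨hP a p.start_mem_support, hP b p.end_mem_support, reachable_induce_of_support p hP⟩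

end Pendant

/-! ### Notation (mirrors the lead's skeleton) -/

/-- The closed half-space `ℍ = {x₀ ≥ 0}`. -/
abbrev HS : Set (Site 3) := {x : Site 3 | 0 ≤ x 0}

/-- The upper half-space `ℍ₊ = {x₀ ≥ 1}`. -/
abbrev HP : Set (Site 3) := {x : Site 3 | 1 ≤ x 0}

/-- The four floor neighbours of the origin. -/
abbrev nbrs : Finset (Site 3) :=
  ({Pi.single 1 1, Pi.single 1 (-1), Pi.single 2 1, Pi.single 2 (-1)} : Finset (Site 3))

/-- `nbrs_floor` (helper, see the module docstring). -/
theorem nbrs_floor : ∀ e ∈ nbrs, e 0 = 0 := by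
  intro e he
  simp only [Finset.mem_insert, Finset.mem_singleton] at he
  rcases he with rfl | rfl | rfl | rfl <;> simp

/-- `neg_mem_nbrs` (helper, see the module docstring). -/
theorem neg_mem_nbrs : ∀ e ∈ nbrs, -e ∈ nbrs := by
  intro e he
  simp only [Finset.mem_insert, Finset.mem_singleton] at he ⊢
  rcases he with rfl | rfl | rfl | rfl <;> simp [← Pi.single_neg]

/-- The pivotal-pair event: `x ↔_ℍ a`, `x' ↔_ℍ b`, `x ↮_ℍ x'`. -/
abbrev pivAt (x x' a b : Site 3) : Set (BondConfig (Site 3)) :=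
  openConnIn HS x a ∩ openConnIn HS x' b ∩ (openConnIn HS x x')ᶜ

/-- `measurableSet_pivAt` (helper, see the module docstring). -/
theorem measurableSet_pivAt (x x' a b : Site 3) : MeasurableSet (pivAt x x' a b) :=
  ((measurableSet_openConnIn_of_countable _ _ _).inter
    (measurableSet_openConnIn_of_countable _ _ _)).inter
    (measurableSet_openConnIn_of_countable _ _ _).compl

/-! ### The concrete coupling: floor edges at level `t`, the other half-space edges at `p_c` -/

section Concrete

/-- The pairs of sites of `ℤ³` (the coordinates of a bond configuration). -/
abbrev E3 : Type := Sym2 (Site 3)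

/-- `p_c(ℤ³)` as a point of `[0,1]`. -/
abbrev pc : unitInterval := criticalProbI 3

/-- The floor edge set. -/
abbrev Fl : Set E3 := floorEdgeSet 3

/-- Base levels: the weights of `P^{ℍ}_{p_c,1}`. -/
abbrev base : E3 → unitInterval := floorDilutedParam 3 pc 1

/-- The coupled configuration at absolute floor level `t`: floor edges with label `≤ t`, other
half-space edges with label `≤ p_c`. -/
abbrev θ (t : ℝ) (U : E3 → ℝ) : Set E3 := levelCfg Fl base t U

/-- The same with the floor edge `f` removed. -/
abbrev θoff (f : E3) (t : ℝ) (U : E3 → ℝ) : Set E3 := levelCfgOff Fl base f t U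

/-- The labels law. -/
abbrev ν : Measure (E3 → ℝ) := unifLabels E3

/-- `pc_pos` (helper, see the module docstring). -/
theorem pc_pos : 0 < (pc : ℝ) := by
  rw [coe_criticalProbI]; exact criticalProb_zd_pos 3 (by norm_num)

/-- `pc_lt_half` (helper, see the module docstring). -/
theorem pc_lt_half : (pc : ℝ) < 1 / 2 := by
  rw [coe_criticalProbI]; exact floorSubcritical_proof

/-- At level `t = s · p_c` the level vector is the weight vector of `P^{ℍ}_{p_c,s}`. -/
theorem lvI_mul_eq (s : unitInterval) : lvI Fl base (s * pc) = floorDilutedParam 3 pc s := by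
  funext i
  by_cases hi : i ∈ Fl
  · rw [floorDilutedParam_of_mem_floorEdgeSet _ _ hi]; simp [lvI, hi]
  · simp only [lvI, hi, if_false]
    show floorDilutedParam 3 pc 1 i = floorDilutedParam 3 pc s i
    by_cases hH : i ∈ halfSpaceEdgeSet 3
    · rw [floorDilutedParam_of_not_mem_floorEdgeSet _ _ hH hi,
        floorDilutedParam_of_not_mem_floorEdgeSet _ _ hH hi]
    · rw [floorDilutedParam_of_not_mem_halfSpaceEdgeSet _ _ hH,
        floorDilutedParam_of_not_mem_halfSpaceEdgeSet _ _ hH]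

/-- **The coupling has the right marginals**: `θ_{s p_c}(U)` has law `P^{ℍ}_{p_c,s}`. -/
theorem ν_preimage_θ (s : unitInterval) {A : Set (Set E3)} (hA : MeasurableSet A) :
    ν ((θ ((s : ℝ) * pc)) ⁻¹' A) = μH s A := by
  have h := map_levelCfg_unifLabels (F := Fl) (c := base) (s * pc)
  rw [lvI_mul_eq] at h
  rw [← Measure.map_apply (measurable_levelCfg _) hA, ← Set.Icc.coe_mul, h]; rfl

/-- In particular at `s = 1` (level `p_c`). -/
theorem ν_preimage_θ_one {A : Set (Set E3)} (hA : MeasurableSet A) :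
    ν ((θ (pc : ℝ)) ⁻¹' A) = μH 1 A := by
  have := ν_preimage_θ 1 hA
  rwa [Set.Icc.coe_one, one_mul] at this

/-- Almost surely every coupled configuration consists of half-space edges. -/
theorem θ_subset_halfSpaceEdgeSet {U : E3 → ℝ} (hU : ∀ i, 0 < U i) (t : ℝ) :
    θ t U ⊆ halfSpaceEdgeSet 3 := by
  intro i hi
  by_contra hH
  have hF : i ∉ Fl := fun h => hH (floorEdgeSet_subset_halfSpaceEdgeSet h)
  rw [mem_levelCfg_iff, lv_of_not_mem hF] at hi
  have h0 : (base i : ℝ) = 0 := by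
    rw [show base i = 0 from floorDilutedParam_of_not_mem_halfSpaceEdgeSet _ _ hH]; rfl
  linarith [hU i]

/-- A floor edge of the level-`t` configuration has label `≤ t`. -/
theorem label_le_of_mem_θ {U : E3 → ℝ} {t : ℝ} {f : E3} (hf : f ∈ Fl) (h : f ∈ θ t U) : U f ≤ t :=
  (mem_levelCfg_of_mem hf t U).1 h

/-- The floor edges of `ℤ³` are the pairs `s(x, x + e)`, `x` on the floor, `e` a floor unit vector. -/
theorem exists_eq_mk_of_mem_floorEdgeSet {f : E3} (hf : f ∈ Fl) :
    ∃ x e : Site 3, x 0 = 0 ∧ e ∈ nbrs ∧ x ≠ x + e ∧ f = s(x, x + e) := by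
  induction f using Sym2.ind with
  | h u v =>
    obtain ⟨hE, hfl⟩ := hf
    have hu : u 0 = 0 := hfl u (Sym2.mem_mk_left _ _)
    have hv : v 0 = 0 := hfl v (Sym2.mem_mk_right _ _)
    have hadj : (zdGraph 3).Adj u v := by simpa using hE
    have hne : u ≠ v := hadj.ne
    obtain ⟨i, h | h⟩ := (zdGraph_adj_iff u v).1 hadj
    · have hi : i ≠ 0 := by
        rintro rfl; have := congrFun h 0; simp [hu, hv] at this
      refine ⟨u, Pi.single i 1, hu, ?_, h ▸ hne, by rw [← h]⟩
      fin_cases i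
      · exact absurd rfl hi
      · simp [nbrs]
      · simp [nbrs]
    · have hi : i ≠ 0 := by
        rintro rfl; have := congrFun h 0; simp [hu, hv] at this
      refine ⟨u, Pi.single i (-1), hu, ?_, ?_, ?_⟩
      · fin_cases i
        · exact absurd rfl hi
        · simp [nbrs]
        · simp [nbrs]
      · intro heq
        apply hne
        rw [heq, h, add_assoc, ← Pi.single_add]; simp
      · congr 1
        rw [h, add_assoc, ← Pi.single_add]; simp

end Concrete

/-! ### The pathwise statement: a floor edge pivotal at its own level, oriented -/

section Pathwise

variable {a b : Site 3}

/-- The oriented pivotal event for the ordered floor pair `(x, x + e)`: at the level of its own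
label, removing the edge leaves `x ↔_ℍ a`, `x + e ↔_ℍ b`, `x ↮_ℍ x + e`. -/
def OPiv (a b x e : Site 3) : Set (E3 → ℝ) :=
  {U | U s(x, x + e) ≤ (pc : ℝ) ∧ θoff s(x, x + e) (U s(x, x + e)) U ∈ pivAt x (x + e) a b}

/-- **Existence of an oriented pivotal floor edge.** For good labels `U` (positive, injective on the
floor edges, finite `ℍ`-cluster of `a` at the top level): if `a ↔_ℍ b` holds at level `p_c` but
`a ↔_{ℍ₊} b` fails there, then some ordered floor pair is pivotal at its own level. -/
theorem exists_oPiv (ha : 1 ≤ a 0) (hb : 1 ≤ b 0) {U : E3 → ℝ} (hpos : ∀ i, 0 < U i)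
    (hinj : Set.InjOn U Fl) (hfin : (clusterIn HS (θ (pc : ℝ) U) a).Finite)
    (hA : θ (pc : ℝ) U ∈ openConnIn HS a b) (hA' : θ (pc : ℝ) U ∉ openConnIn HP a b) :
    ∃ x e : Site 3, x 0 = 0 ∧ e ∈ nbrs ∧ U ∈ OPiv a b x e := by
  classical
  set ω₁ : Set E3 := θ (pc : ℝ) U with hω₁
  set C : Set (Site 3) := clusterIn HS ω₁ a with hC
  have hCsym : C.sym2.Finite := by
    rw [← hfin.coe_toFinset, ← Finset.coe_sym2]; exact Finset.finite_toSet _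
  have hCfin : (C.sym2 ∩ (Fl ∩ ω₁)).Finite := hCsym.subset inter_subset_left
  set Δ : Finset E3 := hCfin.toFinset with hΔ
  have hΔmem : ∀ {d : E3}, d ∈ Δ ↔ d ∈ C.sym2 ∧ d ∈ Fl ∧ d ∈ ω₁ := by
    intro d; simp [hΔ]
  have hΔF : (↑Δ : Set E3) ⊆ Fl := fun d hd => (hΔmem.1 hd).2.1
  set ω₀ : Set E3 := ω₁ \ ↑Δ with hω₀
  have hω₀sub : ω₀ ⊆ ω₁ := Set.sdiff_subset
  have h0 : ω₀ ∉ openConnIn HS a b := by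
    intro h0
    have h1 : ω₀ ∩ C.sym2 ∈ openConnIn HS a b := (conn_iff_inter_sym2_cluster hω₀sub a b).1 h0
    have hsub : ω₀ ∩ C.sym2 ⊆ halfSpaceEdgeSet 3 :=
      fun i hi => θ_subset_halfSpaceEdgeSet hpos _ hi.1.1
    have hnofl : ∀ e ∈ Fl, e ∉ ω₀ ∩ C.sym2 := by
      rintro e heF ⟨⟨he1, heΔ⟩, heC⟩
      exact heΔ (Finset.mem_coe.2 (hΔmem.2 ⟨heC, heF, he1⟩))
    have h2 := conn_upper_of_no_floor hsub hnofl ha hb h1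
    exact hA' (conn_mono_cfg (inter_subset_left.trans hω₀sub) h2)
  -- (ii) `ω₀ ∪ Δ = ω₁ ∈ A`
  have h1 : ω₀ ∪ ↑Δ ∈ openConnIn HS a b := by
    have : ω₀ ∪ ↑Δ = ω₁ := Set.sdiff_union_of_subset fun d hd => (hΔmem.1 hd).2.2
    rw [this]; exact hA
  -- (iii) discrete pivot
  obtain ⟨d, hdΔ, hin, hout⟩ := exists_pivot_of_chain (openConnIn HS a b) U ω₀ Δ (hinj.mono hΔF) h0 h1
  obtain ⟨hdC, hdF, hd1⟩ := hΔmem.1 hdΔ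
  set t : ℝ := U d with ht
  have htpc : t ≤ pc := label_le_of_mem_θ hdF hd1
  -- (iv) the two chain configurations have the traces of `θ_t` and `θ_t ∖ {d}` on the cluster
  have hθt_sub : θ t U ⊆ ω₁ := levelCfg_mono htpc U
  have htrace : (ω₀ ∪ {d' | d' ∈ Δ ∧ U d' ≤ U d}) ∩ C.sym2 = θ t U ∩ C.sym2 := by
    ext e
    constructor
    · rintro ⟨h, heC⟩
      refine ⟨?_, heC⟩
      rcases h with ⟨he1, hnΔ⟩ | ⟨hΔ', hle⟩
      · have heF : e ∉ Fl := fun heF => hnΔ (Finset.mem_coe.2 (hΔmem.2 ⟨heC, heF, he1⟩))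
        exact (mem_levelCfg_of_not_mem heF t (pc : ℝ) U).2 he1
      · exact (mem_levelCfg_of_mem (hΔF (Finset.mem_coe.2 hΔ')) t U).2 hle
    · rintro ⟨het, heC⟩
      refine ⟨?_, heC⟩
      by_cases heF : e ∈ Fl
      · right
        have hle : U e ≤ t := (mem_levelCfg_of_mem heF t U).1 het
        exact ⟨hΔmem.2 ⟨heC, heF, (mem_levelCfg_of_mem heF (pc : ℝ) U).2 (hle.trans htpc)⟩, hle⟩
      · left
        exact ⟨(mem_levelCfg_of_not_mem heF t (pc : ℝ) U).1 het, fun h => heF (hΔF h)⟩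
  -- membership in `θ_t ∖ {d}` on and off the floor
  have hoff_mem : ∀ {e : E3}, e ∈ Fl → (e ∈ θoff d t U ↔ e ≠ d ∧ U e ≤ t) := fun {e} heF => by
    show e ∈ levelCfgOff Fl base d t U ↔ _
    rw [mem_levelCfgOff_iff, lv_of_mem heF t]
  have hoff_not : ∀ {e : E3}, e ∉ Fl → (e ∈ θoff d t U ↔ e ∈ ω₁) := fun {e} heF => by
    show e ∈ levelCfgOff Fl base d t U ↔ e ∈ levelCfg Fl base (pc : ℝ) U
    rw [mem_levelCfgOff_iff, mem_levelCfg_iff, lv_of_not_mem heF t, lv_of_not_mem heF (pc : ℝ)]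
    exact ⟨fun h => h.2, fun h => ⟨fun hed => heF (hed ▸ hdF), h⟩⟩
  have htrace' : (ω₀ ∪ {d' | d' ∈ Δ ∧ U d' < U d}) ∩ C.sym2 = θoff d t U ∩ C.sym2 := by
    ext e
    constructor
    · rintro ⟨h, heC⟩
      refine ⟨?_, heC⟩
      rcases h with ⟨he1, hnΔ⟩ | ⟨hΔ', hlt⟩
      · have heF : e ∉ Fl := fun heF => hnΔ (Finset.mem_coe.2 (hΔmem.2 ⟨heC, heF, he1⟩))
        exact (hoff_not heF).2 he1
      · exact (hoff_mem (hΔF (Finset.mem_coe.2 hΔ'))).2 ⟨fun h => (lt_irrefl _) (h ▸ hlt), hlt.le⟩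
    · rintro ⟨het, heC⟩
      refine ⟨?_, heC⟩
      by_cases heF : e ∈ Fl
      · right
        obtain ⟨hne, hle⟩ := (hoff_mem heF).1 het
        exact ⟨hΔmem.2 ⟨heC, heF, (mem_levelCfg_of_mem heF (pc : ℝ) U).2 (hle.trans htpc)⟩,
          lt_of_le_of_ne hle fun heq => hne (hinj heF hdF heq)⟩
      · left
        exact ⟨(hoff_not heF).1 het, fun h => heF (hΔF h)⟩
  have hsub1 : ω₀ ∪ {d' | d' ∈ Δ ∧ U d' ≤ U d} ⊆ ω₁ :=
    union_subset hω₀sub fun d' hd' => (hΔmem.1 hd'.1).2.2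
  have hsub2 : ω₀ ∪ {d' | d' ∈ Δ ∧ U d' < U d} ⊆ ω₁ :=
    union_subset hω₀sub fun d' hd' => (hΔmem.1 hd'.1).2.2
  have hθoff_sub : θoff d t U ⊆ ω₁ := (levelCfgOff_subset _ _ _).trans hθt_sub
  have hin' : θ t U ∈ openConnIn HS a b := (conn_congr_of_inter_eq hsub1 hθt_sub htrace b).1 hin
  have hout' : θoff d t U ∉ openConnIn HS a b := fun h =>
    hout ((conn_congr_of_inter_eq hsub2 hθoff_sub htrace' b).2 h)
  -- orient the pivotal edge
  obtain ⟨x, e, hx, he, hxe, rfl⟩ := exists_eq_mk_of_mem_floorEdgeSet hdF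
  have hins : insert s(x, x + e) (θoff s(x, x + e) t U) = θ t U := by
    show insert s(x, x + e) (levelCfgOff Fl base s(x, x + e) t U) = levelCfg Fl base t U
    rw [← levelCfg_diff_singleton, insert_sdiff_singleton,
      insert_eq_of_mem ((mem_levelCfg_of_mem hdF t U).2 le_rfl)]
  rw [← hins] at hin'
  rcases pivot_decomp hxe hout' hin' with h | h
  · exact ⟨x, e, hx, he, htpc, ⟨h.1, h.2.1⟩, h.2.2⟩
  · -- the other orientation: base point `x + e`, direction `-e`
    refine ⟨x + e, -e, by simp [hx, nbrs_floor e he], neg_mem_nbrs e he, ?_⟩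
    have hpair : s(x + e, x + e + -e) = s(x, x + e) := by
      rw [add_neg_cancel_right, Sym2.eq_swap]
    show U s(x + e, x + e + -e) ≤ (pc : ℝ) ∧ _
    rw [hpair]
    refine ⟨htpc, ⟨?_, ?_⟩, ?_⟩
    · exact h.1
    · simpa only [add_neg_cancel_right] using h.2.1
    · have h3 : θoff s(x, x + e) t U ∉ openConnIn HS (x + e) x := h.2.2
      simpa only [add_neg_cancel_right, Set.mem_compl_iff] using h3

end Pathwise

/-- **Registered sub-goal `stub_floorCouplingPivot`** (def-free form of `exists_eq_mk_of_mem_floorEdgeSet`). -/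
theorem stub_floorCouplingPivot :
    ∀ f ∈ floorEdgeSet 3, ∃ x e : Site 3, x 0 = 0 ∧
      e ∈ ({Pi.single 1 1, Pi.single 1 (-1), Pi.single 2 1, Pi.single 2 (-1)} : Finset (Site 3)) ∧
        x ≠ x + e ∧ f = s(x, x + e) :=
  fun _ hf => exists_eq_mk_of_mem_floorEdgeSet hf

end Summit.CriticalPhenomena.PercolationContinuityZ3.Theorems.FloorRusso.Coupling

end
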